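import Summits.AtomisticToContinuum.BoseEinsteinCondensation.Theorems.BECCellInformationOneBodyEntropyBoundFVCalc
import HarnessLib

/-!
# Crux `OneBodyEntropyBound` — line `registered`, stub `stub_firstVariation`, part 1: real-integral bridges

Support file (`--supports stmt-AtomisticToContinuum-13440`). The first variation of the energy at a near-minimiser
(part 2, `…FirstVariation.lean`) is an argument about REAL integrals, while the tree's energies are `ℝ≥0∞`-valued
`lintegral`s. This file supplies the dictionary, for an `n`-boson Dirichlet trial state `Φ` of finite energy and a
real `C¹` multiplier `H` with `∇H = q ∇G` (we use `H = G`, `q = 1` and `H = 1 + tG²`, `q = 2tG`):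

* pointwise: the real energy density of `Hψ` is `q²|∇G|²|ψ|² + H²(|∇ψ|² + V|ψ|²) + 2Hq·c` with the cross density `c =
  Σ_{ik} ∂_{ik}G · ⟨ψ, ∂_{ik}ψ⟩_ℝ` (`toReal_density_real_mul`, from `FVCalc.kineticDensity_realMul_toReal`), valid
  wherever `V|ψ|² < ∞`, i.e. almost everywhere (`ae_interaction_normSq_ne_top`);
* the bridge `∫⁻ g = ofReal (∫ F)` when `g` is a.e. finite and `g.toReal = F` a.e. with `F` integrable
  (`lintegral_eq_ofReal_integral`), and the integrability of `|ψ|²`, `|∇ψ|²`, `V|ψ|²` (finite energy) and of the cross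
  density (dominated by `(3nD²|ψ|² + |∇ψ|²)/2`, `FVCalc.abs_cross_le`);
* consequently the energy and the mass of `Hψ` as real integrals (`lintegral_density_real_mul_eq`,
  `lintegral_normSq_real_mul_eq`) and the variational principle `groundStateEnergy_mul_normSq_le` in real form:
  `E₀.toReal · ∫ H²|ψ|² ≤ ∫ F` for symmetric bounded `C¹` `H` (`groundStateEnergy_toReal_mul_le`);
* the elementary extremal lemma `(∀ t, 0 ≤ d + 2tb + t²c) → b ≤ √(d · max c 0)` (`le_sqrt_of_quadratic_nonneg`,
  registered as `stub_quadraticExtremal`).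
-/

noncomputable section

namespace Summit.AtomisticToContinuum.BoseEinsteinCondensation.Cruxes.OneBodyEntropyBound.Birth

namespace FirstVariation

open MeasureTheory Filter Topology
open scoped ENNReal NNReal
open Literature.MathematicalPhysics.QuantumManyBody.BoseGas

variable {n : ℕ}

/-- **Pointwise expansion of `|∇(Hψ)|²`** for a real multiplier `H` with `∇H = q ∇G`:
`|∇(Hψ)|² = q²|∇G|²|ψ|² + H²|∇ψ|² + 2Hq Σ ∂G·⟨ψ, ∂ψ⟩`. [folklore] -/
theorem toReal_kineticDensity_real_mul {H q G : Config n → ℝ} {ψ : Config n → ℂ}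
    (hH : Differentiable ℝ H) (hψ : Differentiable ℝ ψ)
    (hq : ∀ X V, fderiv ℝ H X V = q X * fderiv ℝ G X V) (X : Config n) :
    (kineticDensity (fun X : Config n => (H X : ℂ) * ψ X) X).toReal =
      q X ^ 2 * (∑ i : Fin n, ∑ k : Fin 3, (fderiv ℝ G X (Pi.single i (EuclideanSpace.single k (1 : ℝ)))) ^ 2) * ‖ψ X‖ ^ 2 +
        H X ^ 2 * (kineticDensity ψ X).toReal +
        2 * (H X * q X) * ∑ i : Fin n, ∑ k : Fin 3,
          fderiv ℝ G X (Pi.single i (EuclideanSpace.single k (1 : ℝ))) *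
            inner ℝ (ψ X) (fderiv ℝ ψ X (Pi.single i (EuclideanSpace.single k (1 : ℝ)))) := by
  rw [FVCalc.kineticDensity_realMul_toReal hH hψ]
  simp_rw [hq]
  have h1 : (∑ i : Fin n, ∑ k : Fin 3, (q X * fderiv ℝ G X (Pi.single i (EuclideanSpace.single k (1 : ℝ)))) ^ 2) =
      q X ^ 2 * ∑ i : Fin n, ∑ k : Fin 3, (fderiv ℝ G X (Pi.single i (EuclideanSpace.single k (1 : ℝ)))) ^ 2 := by
    simp only [mul_pow, Finset.mul_sum]
  have h2 : (∑ i : Fin n, ∑ k : Fin 3, q X * fderiv ℝ G X (Pi.single i (EuclideanSpace.single k (1 : ℝ))) *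
      inner ℝ (ψ X) (fderiv ℝ ψ X (Pi.single i (EuclideanSpace.single k (1 : ℝ))))) =
      q X * ∑ i : Fin n, ∑ k : Fin 3, fderiv ℝ G X (Pi.single i (EuclideanSpace.single k (1 : ℝ))) *
        inner ℝ (ψ X) (fderiv ℝ ψ X (Pi.single i (EuclideanSpace.single k (1 : ℝ)))) := by
    simp only [mul_assoc, Finset.mul_sum]
  rw [h1, h2]
  ring

/-- **Pointwise expansion of the energy density of `Hψ`** (where `V|ψ|² < ∞`). [folklore] -/
theorem toReal_density_real_mul (v : ℝ → ℝ≥0∞) {H q G : Config n → ℝ} {ψ : Config n → ℂ}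
    (hH : Differentiable ℝ H) (hψ : Differentiable ℝ ψ)
    (hq : ∀ X V, fderiv ℝ H X V = q X * fderiv ℝ G X V) (X : Config n)
    (hX : interaction v X * ((‖ψ X‖₊ : ℝ≥0∞)) ^ 2 ≠ ⊤) :
    (kineticDensity (fun X : Config n => (H X : ℂ) * ψ X) X +
        interaction v X * ((‖(H X : ℂ) * ψ X‖₊ : ℝ≥0∞)) ^ 2).toReal =
      q X ^ 2 * (∑ i : Fin n, ∑ k : Fin 3,
          (fderiv ℝ G X (Pi.single i (EuclideanSpace.single k (1 : ℝ)))) ^ 2) * ‖ψ X‖ ^ 2 +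
        H X ^ 2 * ((kineticDensity ψ X).toReal +
          (interaction v X * ((‖ψ X‖₊ : ℝ≥0∞)) ^ 2).toReal) +
        2 * (H X * q X) * ∑ i : Fin n, ∑ k : Fin 3,
          fderiv ℝ G X (Pi.single i (EuclideanSpace.single k (1 : ℝ))) *
            inner ℝ (ψ X) (fderiv ℝ ψ X (Pi.single i (EuclideanSpace.single k (1 : ℝ)))) := by
  have h2 : interaction v X * ((‖(H X : ℂ) * ψ X‖₊ : ℝ≥0∞)) ^ 2 ≠ ⊤ := by
    rw [FVCalc.interaction_mul_ennnorm_realMul_sq]; exact ENNReal.mul_ne_top ENNReal.ofReal_ne_top hX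
  rw [ENNReal.toReal_add (FVCalc.kineticDensity_ne_top _ _) h2, toReal_kineticDensity_real_mul hH hψ hq,
    FVCalc.interaction_mul_ennnorm_realMul_sq, ENNReal.toReal_mul, ENNReal.toReal_ofReal (sq_nonneg _)]
  ring

/-! ### From `lintegral`s to Bochner integrals -/

/-- Bridge: if `g` is a.e. finite and its real part agrees a.e. with an integrable `F`, then
`∫⁻ g = ofReal (∫ F)`. [folklore] -/
theorem lintegral_eq_ofReal_integral {α : Type*} [MeasurableSpace α] {μ : Measure α}
    {g : α → ℝ≥0∞} {F : α → ℝ} (hlt : ∀ᵐ x ∂μ, g x ≠ ⊤) (hF : Integrable F μ)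
    (hgF : ∀ᵐ x ∂μ, (g x).toReal = F x) :
    ∫⁻ x, g x ∂μ = ENNReal.ofReal (∫ x, F x ∂μ) := by
  have hF0 : 0 ≤ᵐ[μ] F := hgF.mono fun _ hx => hx ▸ ENNReal.toReal_nonneg
  rw [ofReal_integral_eq_lintegral_ofReal hF hF0]
  refine lintegral_congr_ae ?_
  filter_upwards [hlt, hgF] with x hx hxF
  rw [← hxF, ENNReal.ofReal_toReal hx]

/-- In the bridge situation `∫ F ≥ 0`. [folklore] -/
theorem integral_nonneg_of_toReal_ae_eq {α : Type*} [MeasurableSpace α] {μ : Measure α}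
    {g : α → ℝ≥0∞} {F : α → ℝ} (hgF : ∀ᵐ x ∂μ, (g x).toReal = F x) : 0 ≤ ∫ x, F x ∂μ :=
  integral_nonneg_of_ae (hgF.mono fun _ hx => hx ▸ ENNReal.toReal_nonneg)

/-- Bounded continuous multipliers preserve integrability. [folklore] -/
theorem integrable_bdd_mul {f w : Config n → ℝ} (hw : Integrable w) (hf : Continuous f) {C : ℝ}
    (hC : ∀ X, |f X| ≤ C) : Integrable fun X => f X * w X :=
  hw.bdd_mul hf.aestronglyMeasurable (ae_of_all _ fun X => by rw [Real.norm_eq_abs]; exact hC X)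

variable {L : ℝ} {v : ℝ → ℝ≥0∞}

/-- For a finite-energy state, `V|ψ|² < ∞` almost everywhere. [folklore] -/
theorem ae_interaction_normSq_ne_top (Φ : TrialState n L) (hv : Measurable v) (hE : energy v Φ ≠ ⊤) :
    ∀ᵐ X : Config n, interaction v X * ((‖Φ.ψ X‖₊ : ℝ≥0∞)) ^ 2 ≠ ⊤ := by
  have hm : Measurable fun X => interaction v X * ((‖Φ.ψ X‖₊ : ℝ≥0∞)) ^ 2 :=
    (measurable_interaction hv).mul (measurable_normSq Φ.contDiff.continuous)
  have hle : ∫⁻ X, interaction v X * ((‖Φ.ψ X‖₊ : ℝ≥0∞)) ^ 2 ≤ energy v Φ :=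
    lintegral_mono fun X => le_add_self
  exact (ae_lt_top hm (ne_top_of_le_ne_top hE hle)).mono fun X hX => hX.ne

/-- `|∇ψ|²` (real) is integrable for a finite-energy state. [folklore] -/
theorem integrable_toReal_kineticDensity (Φ : TrialState n L) (hE : energy v Φ ≠ ⊤) :
    Integrable fun X => (kineticDensity Φ.ψ X).toReal :=
  integrable_toReal_of_lintegral_ne_top (measurable_kineticDensity Φ.contDiff).aemeasurable
    (ne_top_of_le_ne_top hE (lintegral_mono fun _ => le_self_add))

/-- `V|ψ|²` (real) is integrable for a finite-energy state. [folklore] -/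
theorem integrable_toReal_interaction_normSq (Φ : TrialState n L) (hv : Measurable v)
    (hE : energy v Φ ≠ ⊤) :
    Integrable fun X => (interaction v X * ((‖Φ.ψ X‖₊ : ℝ≥0∞)) ^ 2).toReal :=
  integrable_toReal_of_lintegral_ne_top
    ((measurable_interaction hv).mul (measurable_normSq Φ.contDiff.continuous)).aemeasurable
    (ne_top_of_le_ne_top hE (lintegral_mono fun _ => le_add_self))

/-- `|ψ|²` is integrable. [folklore] -/
theorem integrable_normSq (Φ : TrialState n L) : Integrable fun X => ‖Φ.ψ X‖ ^ 2 := by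
  have h := integrable_toReal_of_lintegral_ne_top (μ := volume)
    (measurable_normSq Φ.contDiff.continuous).aemeasurable (by rw [Φ.norm_eq]; exact ENNReal.one_ne_top)
  refine h.congr (ae_of_all _ fun X => ?_)
  simp only [coe_nnnorm_pow_two_eq_ofReal, ENNReal.toReal_ofReal (sq_nonneg _)]

/-- `∫ |ψ|² = 1`. [folklore] -/
theorem integral_normSq (Φ : TrialState n L) : ∫ X, ‖Φ.ψ X‖ ^ 2 = 1 := by
  rw [integral_eq_lintegral_of_nonneg_ae (ae_of_all _ fun X => sq_nonneg _)
    ((Φ.contDiff.continuous.norm.pow 2).aestronglyMeasurable)]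
  simp_rw [← coe_nnnorm_pow_two_eq_ofReal]
  rw [Φ.norm_eq, ENNReal.toReal_one]

/-- `∫ (|∇ψ|² + V|ψ|²) = energy` (real form). [folklore] -/
theorem integral_energyDensity (Φ : TrialState n L) (hv : Measurable v) (hE : energy v Φ ≠ ⊤) :
    ∫ X, ((kineticDensity Φ.ψ X).toReal + (interaction v X * ((‖Φ.ψ X‖₊ : ℝ≥0∞)) ^ 2).toReal) =
      (energy v Φ).toReal := by
  have hm : Measurable fun X => kineticDensity Φ.ψ X + interaction v X * ((‖Φ.ψ X‖₊ : ℝ≥0∞)) ^ 2 :=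
    (measurable_kineticDensity Φ.contDiff).add
      ((measurable_interaction hv).mul (measurable_normSq Φ.contDiff.continuous))
  unfold energy
  rw [← integral_toReal hm.aemeasurable]
  · refine integral_congr_ae ?_
    filter_upwards [ae_interaction_normSq_ne_top Φ hv hE] with X hX
    rw [ENNReal.toReal_add (FVCalc.kineticDensity_ne_top _ _) hX]
  · filter_upwards [ae_interaction_normSq_ne_top Φ hv hE] with X hX
    exact lt_top_iff_ne_top.2 (ENNReal.add_ne_top.2 ⟨FVCalc.kineticDensity_ne_top _ _, hX⟩)

/-- Continuity of a partial derivative of a `C¹` function. [folklore] -/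
theorem continuous_fderiv_apply {E' : Type*} [NormedAddCommGroup E'] [NormedSpace ℝ E']
    {f : Config n → E'} (hf : ContDiff ℝ 1 f) (V : Config n) : Continuous fun X => fderiv ℝ f X V :=
  (hf.continuous_fderiv one_ne_zero).clm_apply continuous_const

/-- `|∇G|²` is continuous. [folklore] -/
theorem continuous_gradSq {G : Config n → ℝ} (hG : ContDiff ℝ 1 G) :
    Continuous fun X => ∑ i : Fin n, ∑ k : Fin 3, (fderiv ℝ G X (Pi.single i (EuclideanSpace.single k (1 : ℝ)))) ^ 2 :=
  continuous_finsetSum _ fun _ _ => continuous_finsetSum _ fun _ _ => (continuous_fderiv_apply hG _).pow 2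

/-- The cross term is continuous. [folklore] -/
theorem continuous_cross {G : Config n → ℝ} (hG : ContDiff ℝ 1 G) {ψ : Config n → ℂ} (hψ : ContDiff ℝ 1 ψ) :
    Continuous fun X => ∑ i : Fin n, ∑ k : Fin 3,
      fderiv ℝ G X (Pi.single i (EuclideanSpace.single k (1 : ℝ))) *
        inner ℝ (ψ X) (fderiv ℝ ψ X (Pi.single i (EuclideanSpace.single k (1 : ℝ)))) :=
  continuous_finsetSum _ fun _ _ => continuous_finsetSum _ fun _ _ =>
    (continuous_fderiv_apply hG _).mul (hψ.continuous.inner (continuous_fderiv_apply hψ _))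

/-- The cross term is integrable (dominated by `(3nD²|ψ|² + |∇ψ|²)/2`). [folklore] -/
theorem integrable_cross {G : Config n → ℝ} (hG : ContDiff ℝ 1 G) {D : ℝ} (hD : ∀ X, ‖fderiv ℝ G X‖ ≤ D)
    (Φ : TrialState n L) (hE : energy v Φ ≠ ⊤) :
    Integrable fun X => ∑ i : Fin n, ∑ k : Fin 3,
      fderiv ℝ G X (Pi.single i (EuclideanSpace.single k (1 : ℝ))) *
        inner ℝ (Φ.ψ X) (fderiv ℝ Φ.ψ X (Pi.single i (EuclideanSpace.single k (1 : ℝ)))) := by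
  refine Integrable.mono'
    (g := fun X => ((3 * n * D ^ 2) * ‖Φ.ψ X‖ ^ 2 + (kineticDensity Φ.ψ X).toReal) / 2) ?_
    (continuous_cross hG Φ.contDiff).aestronglyMeasurable (ae_of_all _ fun X => ?_)
  · exact (((integrable_normSq Φ).const_mul _).add (integrable_toReal_kineticDensity Φ hE)).div_const 2
  · rw [Real.norm_eq_abs]
    refine (FVCalc.abs_cross_le G Φ.ψ X).trans ?_
    gcongr
    exact FVCalc.sum_sq_fderiv_le hD X

/-! ### The quadratic form of `Hψ` in real terms -/

/-- **Energy of `Hψ` as a real integral.** [folklore] -/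
theorem lintegral_density_real_mul_eq (Φ : TrialState n L) (hv : Measurable v) (hE : energy v Φ ≠ ⊤)
    {H q G : Config n → ℝ} (hH : ContDiff ℝ 1 H) (hq : ∀ X V, fderiv ℝ H X V = q X * fderiv ℝ G X V)
    {F : Config n → ℝ} (hF : Integrable F)
    (hFeq : ∀ X, q X ^ 2 * (∑ i : Fin n, ∑ k : Fin 3,
        (fderiv ℝ G X (Pi.single i (EuclideanSpace.single k (1 : ℝ)))) ^ 2) * ‖Φ.ψ X‖ ^ 2 +
        H X ^ 2 * ((kineticDensity Φ.ψ X).toReal +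
          (interaction v X * ((‖Φ.ψ X‖₊ : ℝ≥0∞)) ^ 2).toReal) +
        2 * (H X * q X) * (∑ i : Fin n, ∑ k : Fin 3,
          fderiv ℝ G X (Pi.single i (EuclideanSpace.single k (1 : ℝ))) *
            inner ℝ (Φ.ψ X) (fderiv ℝ Φ.ψ X (Pi.single i (EuclideanSpace.single k (1 : ℝ))))) = F X) :
    ∫⁻ X, (kineticDensity (fun X : Config n => (H X : ℂ) * Φ.ψ X) X +
        interaction v X * ((‖(H X : ℂ) * Φ.ψ X‖₊ : ℝ≥0∞)) ^ 2) = ENNReal.ofReal (∫ X, F X) := by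
  refine lintegral_eq_ofReal_integral ?_ hF ?_
  · filter_upwards [ae_interaction_normSq_ne_top Φ hv hE] with X hX
    exact ENNReal.add_ne_top.2 ⟨FVCalc.kineticDensity_ne_top _ _, by
      rw [FVCalc.interaction_mul_ennnorm_realMul_sq]; exact ENNReal.mul_ne_top ENNReal.ofReal_ne_top hX⟩
  · filter_upwards [ae_interaction_normSq_ne_top Φ hv hE] with X hX
    rw [toReal_density_real_mul v (hH.differentiable one_ne_zero)
      (Φ.contDiff.differentiable one_ne_zero) hq X hX, hFeq]

/-- In the same situation `0 ≤ ∫ F`. [folklore] -/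
theorem integral_density_nonneg (Φ : TrialState n L) (hv : Measurable v) (hE : energy v Φ ≠ ⊤)
    {H q G : Config n → ℝ} (hH : ContDiff ℝ 1 H) (hq : ∀ X V, fderiv ℝ H X V = q X * fderiv ℝ G X V)
    {F : Config n → ℝ}
    (hFeq : ∀ X, q X ^ 2 * (∑ i : Fin n, ∑ k : Fin 3,
        (fderiv ℝ G X (Pi.single i (EuclideanSpace.single k (1 : ℝ)))) ^ 2) * ‖Φ.ψ X‖ ^ 2 +
        H X ^ 2 * ((kineticDensity Φ.ψ X).toReal +
          (interaction v X * ((‖Φ.ψ X‖₊ : ℝ≥0∞)) ^ 2).toReal) +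
        2 * (H X * q X) * (∑ i : Fin n, ∑ k : Fin 3,
          fderiv ℝ G X (Pi.single i (EuclideanSpace.single k (1 : ℝ))) *
            inner ℝ (Φ.ψ X) (fderiv ℝ Φ.ψ X (Pi.single i (EuclideanSpace.single k (1 : ℝ))))) = F X) :
    0 ≤ ∫ X, F X := by
  refine integral_nonneg_of_ae ?_
  filter_upwards [ae_interaction_normSq_ne_top Φ hv hE] with X hX
  rw [Pi.zero_apply, ← hFeq, ← toReal_density_real_mul v (hH.differentiable one_ne_zero)
    (Φ.contDiff.differentiable one_ne_zero) hq X hX]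
  exact ENNReal.toReal_nonneg

/-- **Mass of `Hψ` as a real integral.** [folklore] -/
theorem lintegral_normSq_real_mul_eq (Φ : TrialState n L) {H : Config n → ℝ} (hH : Continuous H) {C : ℝ}
    (hC : ∀ X, |H X| ≤ C) :
    ∫⁻ X, ((‖(H X : ℂ) * Φ.ψ X‖₊ : ℝ≥0∞)) ^ 2 = ENNReal.ofReal (∫ X, H X ^ 2 * ‖Φ.ψ X‖ ^ 2) := by
  refine lintegral_eq_ofReal_integral (ae_of_all _ fun X => ENNReal.pow_ne_top ENNReal.coe_ne_top) ?_
    (ae_of_all _ fun X => ?_)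
  · exact integrable_bdd_mul (integrable_normSq Φ) (hH.pow 2) (C := C ^ 2) fun X => by
      rw [abs_pow]; exact pow_le_pow_left₀ (abs_nonneg _) (hC X) 2
  · rw [DenseCell.ennnorm_real_mul_sq, ENNReal.toReal_mul, ENNReal.toReal_ofReal (sq_nonneg _),
      coe_nnnorm_pow_two_eq_ofReal, ENNReal.toReal_ofReal (sq_nonneg _)]

/-- **Variational inequality for `Hψ` in real terms**: `E₀ ∫ H²|ψ|² ≤ 𝓔[Hψ]` for `C¹` symmetric
bounded `H`. [cite: LSSY2005, (2.3)] -/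
theorem groundStateEnergy_toReal_mul_le (Φ : TrialState n L) (hv : Measurable v) (hE : energy v Φ ≠ ⊤)
    {H q G : Config n → ℝ} (hH : ContDiff ℝ 1 H) (hq : ∀ X V, fderiv ℝ H X V = q X * fderiv ℝ G X V)
    (hHsymm : ∀ (σ : Equiv.Perm (Fin n)) (X : Config n), H (X ∘ σ) = H X) {C : ℝ} (hC : ∀ X, |H X| ≤ C)
    {F : Config n → ℝ} (hF : Integrable F)
    (hFeq : ∀ X, q X ^ 2 * (∑ i : Fin n, ∑ k : Fin 3,
        (fderiv ℝ G X (Pi.single i (EuclideanSpace.single k (1 : ℝ)))) ^ 2) * ‖Φ.ψ X‖ ^ 2 +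
        H X ^ 2 * ((kineticDensity Φ.ψ X).toReal +
          (interaction v X * ((‖Φ.ψ X‖₊ : ℝ≥0∞)) ^ 2).toReal) +
        2 * (H X * q X) * (∑ i : Fin n, ∑ k : Fin 3,
          fderiv ℝ G X (Pi.single i (EuclideanSpace.single k (1 : ℝ))) *
            inner ℝ (Φ.ψ X) (fderiv ℝ Φ.ψ X (Pi.single i (EuclideanSpace.single k (1 : ℝ))))) = F X) :
    (groundStateEnergy v n L).toReal * ∫ X, H X ^ 2 * ‖Φ.ψ X‖ ^ 2 ≤ ∫ X, F X := by
  have hφ : ContDiff ℝ 1 fun X : Config n => (H X : ℂ) * Φ.ψ X :=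
    (Complex.ofRealCLM.contDiff.comp hH).mul Φ.contDiff
  have h0 : ∀ Y, Y ∉ boxN n L → (fun X : Config n => (H X : ℂ) * Φ.ψ X) Y = 0 := fun Y hY => by
    simp [Φ.eq_zero Y hY]
  have hs : ∀ (σ : Equiv.Perm (Fin n)) (Y : Config n),
      (fun X : Config n => (H X : ℂ) * Φ.ψ X) (Y ∘ σ) = (fun X : Config n => (H X : ℂ) * Φ.ψ X) Y :=
    fun σ Y => by simp only [hHsymm, Φ.symm]
  have h := groundStateEnergy_mul_normSq_le v hφ h0 hs
  have h' : groundStateEnergy v n L * ENNReal.ofReal (∫ X, H X ^ 2 * ‖Φ.ψ X‖ ^ 2) ≤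
      ENNReal.ofReal (∫ X, F X) := by
    have h1 := lintegral_normSq_real_mul_eq Φ hH.continuous hC
    have h2 := lintegral_density_real_mul_eq Φ hv hE hH hq hF hFeq
    calc groundStateEnergy v n L * ENNReal.ofReal (∫ X, H X ^ 2 * ‖Φ.ψ X‖ ^ 2)
        = groundStateEnergy v n L * ∫⁻ X, ((‖(H X : ℂ) * Φ.ψ X‖₊ : ℝ≥0∞)) ^ 2 := by rw [h1]
      _ ≤ _ := h
      _ = _ := h2
  have h3 := ENNReal.toReal_mono ENNReal.ofReal_ne_top h'
  rwa [ENNReal.toReal_mul, ENNReal.toReal_ofReal (integral_nonneg fun X => mul_nonneg (sq_nonneg _) (sq_nonneg _)),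
    ENNReal.toReal_ofReal (integral_density_nonneg Φ hv hE hH hq hFeq)] at h3

/-! ### The elementary extremal lemma -/

/-- If `0 ≤ d + 2tb + t²c` for all real `t` (`d ≥ 0`), then `b ≤ √(d · max c 0)`. [folklore] -/
theorem le_sqrt_of_quadratic_nonneg {d b c : ℝ} (hd : 0 ≤ d) (h : ∀ t : ℝ, 0 ≤ d + 2 * t * b + t ^ 2 * c) :
    b ≤ Real.sqrt (d * max c 0) := by
  rcases le_or_gt b 0 with hb | hb
  · exact hb.trans (Real.sqrt_nonneg _)
  set m := max c 0 with hm
  have hm0 : 0 ≤ m := le_max_right _ _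
  have hcm : c ≤ m := le_max_left _ _
  have key : ∀ τ : ℝ, 0 < τ → 2 * τ * b ≤ d + τ ^ 2 * m := by
    intro τ hτ
    have h1 := h (-τ)
    nlinarith [mul_le_mul_of_nonneg_left hcm (sq_nonneg τ)]
  rcases eq_or_lt_of_le hm0 with hm00 | hmpos
  · -- `m = 0`: `2τb ≤ d` for all `τ > 0` contradicts `b > 0`
    exfalso
    have h1 := key ((d + 1) / b) (div_pos (by linarith) hb)
    rw [← hm00, mul_zero, add_zero] at h1
    have : 2 * ((d + 1) / b) * b = 2 * (d + 1) := by field_simp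
    linarith
  · have h1 := key (b / m) (div_pos hb hmpos)
    have h2 : b ^ 2 ≤ d * m := by
      have e1 : 2 * (b / m) * b = 2 * (b ^ 2 / m) := by ring
      have e2 : (b / m) ^ 2 * m = b ^ 2 / m := by field_simp
      rw [e1, e2] at h1
      have h3 : b ^ 2 / m ≤ d := by linarith
      rwa [div_le_iff₀ hmpos] at h3
    exact (le_abs_self b).trans (Real.abs_le_sqrt h2)

end FirstVariation

/-- **Registered helper stub `stub_quadraticExtremal`** (for `stub_firstVariation`): if the real quadratic
`d + 2tb + t²c` is nonnegative for every real `t` and `d ≥ 0`, then `b ≤ √(d · max c 0)`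
(`FirstVariation.le_sqrt_of_quadratic_nonneg`). [folklore] -/
theorem stub_quadraticExtremal :
    ∀ d b c : ℝ, 0 ≤ d → (∀ t : ℝ, 0 ≤ d + 2 * t * b + t ^ 2 * c) → b ≤ Real.sqrt (d * max c 0) :=
  fun _ _ _ hd h => FirstVariation.le_sqrt_of_quadratic_nonneg hd h

end Summit.AtomisticToContinuum.BoseEinsteinCondensation.Cruxes.OneBodyEntropyBound.Birth

end
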